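import Mathlib
import Literature.AlgebraicGeometry.Resolution.AdaptedCoordinateChartStep
import HarnessLib

/-!
# Shear-lift recursion along a rational `τ = 1` unit chain (the `u₂`-part of CJS Claim 13.8)

Topic: `Literature/AlgebraicGeometry/Resolution`. V. Cossart, U. Jannsen, S. Saito, *Desingularization:
invariants and strategy*, Lecture Notes in Math. 2270 (2020), Claim 13.8 (`u₂ ↦ u₂ + Σ φ_q u₁^{q+1}`)
[cite: CossartJannsenSaito2020, Claim 13.8]; V. Cossart, O. Piltant, *Resolution of singularities of
threefolds in positive characteristic II*, J. Algebra 321 (2009), proof of Prop. 4.4 p. 11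
[cite: CossartPiltant2008, Prop. 4.4].

OURS (brick B3 of the `τ = 1` endgame; the `τ = 1` twin of
`AdaptedChainRecursion.exists_corrected_coordinates` for the `u₂`-slot only). Along a chain
`R_0 → R_1 → ⋯` of three-dimensional regular local rings with a distinguished parameter `u_n`
(`u_{n+1} = φ_n u_n`), point steps (the near point is rational, on the `u`-chart, with `y/u` in its
maximal ideal) and curve steps (blowing up `(y, u_n)`), where at every level every regular system of
parameters has `τ = 1` and `I_n` has order exactly `μ`, we construct level-`0` third parameters
`v_N` (`v_0 = w_0`, `v_{N+1} − v_N ∈ (u_0^{p_N})`, `p_N = 1 + #{point steps < N}`) whose transports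
`w_n` down the chain are AXIAL at every point step `n < N` (`φ_n w_n = φ_n u_n · w_{n+1}`) and
unchanged at curve steps, each `(y, u_n, w_n)` being a regular system of parameters for some adapted
`y` (lying on the centre `P_n` at curve steps). WHERE THE ADAPTED `y` COMES FROM (it is auxiliary
and never lifted): a monic element of `I_0` (adaptedness, CP (10)) is transported level by level by
`MonicTransport.hasMonic_of_monic_of_chart` (CP (11), CJS Lemma 12.1 (2)), so at every level the
directrix form has a nonzero `Y`-component relative to `(U, W)` for the `w` the recursion produced;
`τ = 1` then re-adapts by `y ↦ y + b u + c w` (`ReAdaptation.exists_linShape_of_hironakaTauAt_eq_one`,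
CP §4 p. 11, CJS §8), and at a curve level `I_n ⊆ P_n^μ` (`hIP`) forces `c = 0`, i.e. the adapted
`y` lies on the centre — all packaged in `AdaptedCoordinateChartStep.lean`.

The main theorem is `exists_shearLift_coordinates`. F-71 / T1 / N2 are NOT proved here; no summit
statement is proved.
-/

noncomputable section

open IsLocalRing MvPolynomial

namespace Literature.AlgebraicGeometry.Resolution

universe u

/-- `(y, u, w − s u) = (y, u, w)` as ideals. [folklore] -/
private theorem span_triple_sub_mul_snd {R : Type u} [CommRing R] (y u w s : R) :
    Ideal.span ({y, u, w - s * u} : Set R) = Ideal.span {y, u, w} := by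
  apply le_antisymm
  · rw [Ideal.span_le]
    rintro x (rfl | rfl | rfl)
    · exact Ideal.subset_span (by simp)
    · exact Ideal.subset_span (by simp)
    · exact Ideal.sub_mem _ (Ideal.subset_span (by simp))
        (Ideal.mul_mem_left _ _ (Ideal.subset_span (by simp)))
  · rw [Ideal.span_le]
    rintro x (rfl | rfl | rfl)
    · exact Ideal.subset_span (by simp)
    · exact Ideal.subset_span (by simp)
    · have h1 : x - s * u ∈ Ideal.span ({y, u, x - s * u} : Set R) := Ideal.subset_span (by simp)
      have h2 : u ∈ Ideal.span ({y, u, x - s * u} : Set R) := Ideal.subset_span (by simp)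
      have h := Ideal.add_mem _ h1 (Ideal.mul_mem_left _ s h2)
      rwa [sub_add_cancel] at h

/-- `(y, u, w + s u) = (y, u, w)` as ideals. [folklore] -/
private theorem span_triple_add_mul_snd {R : Type u} [CommRing R] (y u w s : R) :
    Ideal.span ({y, u, w + s * u} : Set R) = Ideal.span {y, u, w} := by
  rw [← sub_neg_eq_add, ← neg_mul]
  exact span_triple_sub_mul_snd y u w (-s)

/-! ## The recursion along the chain -/

section Chain

variable {Rn : ℕ → Type u} [∀ n, CommRing (Rn n)] [∀ n, IsRegularLocalRing (Rn n)]
  (hdim : ∀ n, ringKrullDim (Rn n) = 3) (φ : ∀ n, Rn n →+* Rn (n + 1)) [∀ n, IsLocalHom (φ n)]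
  (I : ∀ n, Ideal (Rn n)) {μ : ℕ} (hμ : 1 ≤ μ) (u : ∀ n, Rn n) (hu : ∀ n, u (n + 1) = φ n (u n))
  (pt : ℕ → Prop)
  (hIμ : ∀ n, I n ≤ maximalIdeal (Rn n) ^ μ) (hIne : ∀ n, ¬ I n ≤ maximalIdeal (Rn n) ^ (μ + 1))
  (hτ : ∀ n (c : Fin 3 → Rn n), Ideal.span {c 0, c 1, c 2} = maximalIdeal (Rn n) →
    hironakaTauAt c (I n) μ = 1)
  (hres : ∀ n, Function.Surjective (ResidueField.map (φ n)))
  (hI : ∀ n, I (n + 1) = ((I n).map (φ n)).colon {φ n (u n) ^ μ})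
  (P : ∀ n, Ideal (Rn n)) (hIP : ∀ n, ¬ pt n → I n ≤ P n ^ μ)

include hres in
/-- Residues along a rational chain are reached from `R_0`. [folklore] -/
private theorem exists_residue_compHom_eq_of_map_surjective (n : ℕ) (t : ResidueField (Rn n)) :
    ∃ r : Rn 0, residue _ (compHom φ n r) = t := by
  refine residue_compHom_surjective φ (fun m s => ?_) n t
  obtain ⟨x, hx⟩ := hres m s
  obtain ⟨r, rfl⟩ := residue_surjective x
  exact ⟨r, by rw [RingHom.comp_apply, ← ResidueField.map_residue, hx]⟩

omit [∀ n, IsLocalHom (φ n)] in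
include hdim hμ hu hIμ hIne hτ hI hIP in
/-- **The adapted coordinate at the next level.** Given an adapted regular system `(y, u_n, w)` at
level `n`, the transform `y′` (`φ y = φ u_n · y′`) and a third parameter `w′` at level `n + 1` with
`(y′, u_{n+1}, w′) = 𝔪_{n+1}`, `φ(𝔪_n) R_{n+1} ⊆ (u_{n+1}, w′)` and `φ(I_n) R_{n+1} ⊆ (φ u_n^μ)`,
there is an adapted `y″` with `(y″, u_{n+1}, w′) = 𝔪_{n+1}`, lying on the prescribed centre
`P_{n+1} = (y′ + r₁ u_{n+1} + r₂ w′, u_{n+1})` when `n + 1` is a curve step.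
[cite: CossartJannsenSaito2020, Claim 13.8] [cite: CossartPiltant2008, §4 p. 11] -/
theorem exists_adapted_coordinate_succ (n : ℕ) (y w : Rn n)
    (hgen : Ideal.span {y, u n, w} = maximalIdeal (Rn n))
    (had : ∀ G ∈ initialForms ![y, u n, w] (I n) μ, ∃ a : ResidueField (Rn n), G = C a * X 0 ^ μ)
    (y' w' : Rn (n + 1)) (hgen' : Ideal.span {y', u (n + 1), w'} = maximalIdeal (Rn (n + 1)))
    (h₀ : φ n y = φ n (u n) * y')
    (hφ : (maximalIdeal (Rn n)).map (φ n) ≤ Ideal.span {u (n + 1), w'})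
    (hJφ : (I n).map (φ n) ≤ Ideal.span {φ n (u n) ^ μ})
    (hP : ¬ pt (n + 1) → ∃ r₁ r₂ : Rn (n + 1),
      Ideal.span {y' + (r₁ * u (n + 1) + r₂ * w'), u (n + 1)} = P (n + 1)) :
    ∃ y'' : Rn (n + 1), Ideal.span {y'', u (n + 1), w'} = maximalIdeal (Rn (n + 1)) ∧
      (¬ pt (n + 1) → Ideal.span {y'', u (n + 1)} = P (n + 1)) ∧
      ∀ G ∈ initialForms ![y'', u (n + 1), w'] (I (n + 1)) μ,
        ∃ a : ResidueField (Rn (n + 1)), G = C a * X 0 ^ μ := by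
  have hmon : HasMonic ![y', u (n + 1), w'] (I (n + 1)) μ := by
    rw [hu n]
    rw [hu n] at hgen' hφ
    refine hasMonic_of_chart_step (hdim n) (φ n) y (u n) w hgen (hIμ n) (hIne n) had y' w' hgen'
      (hdim (n + 1)) h₀ hφ (hIμ (n + 1)) hJφ fun g' hg' => ?_
    rw [hI n, Submodule.mem_colon_singleton, smul_eq_mul, mul_comm]
    exact hg'
  exact exists_adapted_coordinate_of_hasMonic (hdim (n + 1)) y' (u (n + 1)) w' hgen' (hIμ (n + 1)) hμ
    (hτ (n + 1)) hmon (¬ pt (n + 1)) (P (n + 1)) hP (hIP (n + 1))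

variable
  (hpoint : ∀ n, pt n → ∀ (y w : Rn n), Ideal.span {y, u n, w} = maximalIdeal (Rn n) →
    (∀ G ∈ initialForms ![y, u n, w] (I n) μ, ∃ a : ResidueField (Rn n), G = C a * X 0 ^ μ) →
    ∃ (a : Rn n) (y' w' : Rn (n + 1)), φ n y = φ n (u n) * y' ∧ φ n (w - a * u n) = φ n (u n) * w' ∧
      Ideal.span {y', φ n (u n), w'} = maximalIdeal (Rn (n + 1)))
  (hcurve : ∀ n, ¬ pt n → ∀ (y w : Rn n), Ideal.span {y, u n} = P n →
    Ideal.span {y, u n, w} = maximalIdeal (Rn n) →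
    (∀ G ∈ initialForms ![y, u n, w] (I n) μ, ∃ a : ResidueField (Rn n), G = C a * X 0 ^ μ) →
    ∃ y' : Rn (n + 1), φ n y = φ n (u n) * y' ∧
      Ideal.span {y', φ n (u n), φ n w} = maximalIdeal (Rn (n + 1)))
  (hPsucc_pt : ∀ n, pt n → ¬ pt (n + 1) → ∀ (y w : Rn n) (y' : Rn (n + 1)),
    Ideal.span {y, u n, w} = maximalIdeal (Rn n) →
    (∀ G ∈ initialForms ![y, u n, w] (I n) μ, ∃ a : ResidueField (Rn n), G = C a * X 0 ^ μ) →
    φ n y = φ n (u n) * y' → Ideal.span {y', u (n + 1)} = P (n + 1))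
  (hPsucc_cv : ∀ n, ¬ pt n → ¬ pt (n + 1) → ∀ (y w : Rn n) (y' : Rn (n + 1)),
    Ideal.span {y, u n} = P n →
    Ideal.span {y, u n, w} = maximalIdeal (Rn n) →
    (∀ G ∈ initialForms ![y, u n, w] (I n) μ, ∃ a : ResidueField (Rn n), G = C a * X 0 ^ μ) →
    φ n y = φ n (u n) * y' →
    u (n + 1) ∈ P (n + 1) ∧ ∃ β ∈ maximalIdeal (Rn n), Ideal.span {y' + φ n β, u (n + 1)} = P (n + 1))
  (p : ℕ → ℕ) (hp0 : p 0 = 1)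
  (hpS : ∀ N, (pt N → p (N + 1) = p N + 1) ∧ (¬ pt N → p (N + 1) = p N))

include hpS in
omit [∀ n, IsRegularLocalRing (Rn n)] in
/-- The exponent counter `p_N = 1 + #{point steps < N}` is monotone. [folklore] -/
private theorem shearLift_exp_mono {m n : ℕ} (h : m ≤ n) : p m ≤ p n := by
  obtain ⟨k, rfl⟩ := Nat.exists_eq_add_of_le h
  induction k with
  | zero => simp
  | succ k ih =>
    refine (ih (Nat.le_add_right m k)).trans ?_
    rw [← Nat.add_assoc]
    by_cases hq : pt (m + k)
    · rw [(hpS (m + k)).1 hq]; exact Nat.le_succ _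
    · rw [(hpS (m + k)).2 hq]

omit [∀ n, IsLocalHom (φ n)] in
include hdim hIμ in
/-- **Depth `0`**: the given adapted system `(y₀, u₀, w₀)` starts the recursion (level `0` is a
point step, so no centre condition). [cite: CossartJannsenSaito2020, Claim 13.8] -/
theorem shearLift_zero (hpt0 : pt 0) (c₀ : Fin 3 → Rn 0)
    (hc₀ : Ideal.span {c₀ 0, c₀ 1, c₀ 2} = maximalIdeal (Rn 0)) (hc₀u : c₀ 1 = u 0)
    (hδ₀ : μ.factorial < deltaS c₀ (I 0) μ) :
    ∃ w : ∀ n, Rn n, w 0 = c₀ 2 ∧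
      (∀ n, n < 0 → pt n → φ n (w n) = φ n (u n) * w (n + 1)) ∧
      (∀ n, n < 0 → ¬ pt n → w (n + 1) = φ n (w n)) ∧
      (∀ n, n ≤ 0 → ∃ y : Rn n, Ideal.span {y, u n, w n} = maximalIdeal (Rn n) ∧
        (¬ pt n → Ideal.span {y, u n} = P n) ∧
        ∀ G ∈ initialForms ![y, u n, w n] (I n) μ, ∃ a : ResidueField (Rn n), G = C a * X 0 ^ μ) := by
  refine ⟨fun n => compHom φ n (c₀ 2), rfl, fun n hn => absurd hn (Nat.not_lt_zero n),
    fun n hn => absurd hn (Nat.not_lt_zero n), fun n hn => ?_⟩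
  obtain rfl := Nat.le_zero.mp hn
  refine ⟨c₀ 0, ?_, fun h => absurd hpt0 h, ?_⟩
  · show Ideal.span {c₀ 0, u 0, c₀ 2} = _
    rw [← hc₀u]; exact hc₀
  · have hc : (![c₀ 0, u 0, compHom φ 0 (c₀ 2)] : Fin 3 → Rn 0) = c₀ := by
      funext i
      fin_cases i
      · rfl
      · exact hc₀u.symm
      · rfl
    rw [hc]
    exact forall_initialForms_of_lt_deltaS c₀ hc₀ (hdim 0) (hIμ 0) hδ₀

include hdim hμ hu hIμ hIne hτ hres hI hIP hpoint hcurve hPsucc_pt hPsucc_cv hp0 hpS in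
/-- **Depth `N → N + 1`.** Given third parameters `w_n` of depth `N` over `v`, the near point of
level `N + 1` is made the origin of the `u`-chart: at a point step the residue `ā` of the
translation `w_N ↦ w_N − a u_N` is lifted to `ℓ ∈ R_0` and `v ↦ v − ℓ u_0^{p_N}`
(`w_n ↦ w_n − Φ_n(ℓ) u_n^{p_N − p_n + 1}`, which keeps the lower levels axial and their adapted `y`);
at a curve step nothing changes below. The adapted `y` at level `N + 1` comes from
`exists_adapted_coordinate_succ`. [cite: CossartJannsenSaito2020, Claim 13.8]
[cite: CossartPiltant2008, Prop. 4.4 (proof, p. 11)] -/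
theorem shearLift_succ (N : ℕ) (v : Rn 0)
    (h : ∃ w : ∀ n, Rn n, w 0 = v ∧
      (∀ n, n < N → pt n → φ n (w n) = φ n (u n) * w (n + 1)) ∧
      (∀ n, n < N → ¬ pt n → w (n + 1) = φ n (w n)) ∧
      (∀ n, n ≤ N → ∃ y : Rn n, Ideal.span {y, u n, w n} = maximalIdeal (Rn n) ∧
        (¬ pt n → Ideal.span {y, u n} = P n) ∧
        ∀ G ∈ initialForms ![y, u n, w n] (I n) μ, ∃ a : ResidueField (Rn n), G = C a * X 0 ^ μ)) :
    ∃ v' : Rn 0, v' - v ∈ Ideal.span {u 0 ^ p N} ∧ (¬ pt N → v' = v) ∧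
      ∃ w : ∀ n, Rn n, w 0 = v' ∧
        (∀ n, n < N + 1 → pt n → φ n (w n) = φ n (u n) * w (n + 1)) ∧
        (∀ n, n < N + 1 → ¬ pt n → w (n + 1) = φ n (w n)) ∧
        (∀ n, n ≤ N + 1 → ∃ y : Rn n, Ideal.span {y, u n, w n} = maximalIdeal (Rn n) ∧
          (¬ pt n → Ideal.span {y, u n} = P n) ∧
          ∀ G ∈ initialForms ![y, u n, w n] (I n) μ, ∃ a : ResidueField (Rn n), G = C a * X 0 ^ μ) := by
  classical
  obtain ⟨w, hw0, hax, hcv, hgood⟩ := h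
  obtain ⟨y, hgenN, hPN, hadN⟩ := hgood N le_rfl
  have hpmono : ∀ {m n : ℕ}, m ≤ n → p m ≤ p n := fun h => shearLift_exp_mono pt p hpS h
  by_cases hN : pt N
  · -- POINT STEP at level `N`
    obtain ⟨a, y', w', hy', hw', hgen'⟩ := hpoint N hN y (w N) hgenN hadN
    have hwN : φ N (w N) = φ N (u N) * (w' + φ N a) := by
      rw [map_sub, map_mul] at hw'
      linear_combination hw'
    -- `φ(𝔪_N) R_{N+1} = (φ u_N)`
    have hmap : (maximalIdeal (Rn N)).map (φ N) ≤ Ideal.span {φ N (u N)} := by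
      rw [← hgenN, Ideal.map_span, Ideal.span_le]
      rintro _ ⟨x, hx, rfl⟩
      rcases hx with rfl | rfl | rfl
      · exact Ideal.mem_span_singleton'.mpr ⟨y', by rw [hy', mul_comm]⟩
      · exact Ideal.subset_span rfl
      · exact Ideal.mem_span_singleton'.mpr ⟨w' + φ N a, by rw [hwN, mul_comm]⟩
    -- the lift `ℓ ∈ R_0` of the residue of `a`
    obtain ⟨ℓ, hℓ⟩ := exists_residue_compHom_eq_of_map_surjective φ hres N (residue _ a)
    have haℓ : a - compHom φ N ℓ ∈ maximalIdeal (Rn N) := by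
      rw [← residue_eq_zero_iff, map_sub, hℓ, sub_self]
    obtain ⟨t, ht⟩ : ∃ t : Rn (N + 1), φ N (a - compHom φ N ℓ) = t * φ N (u N) := by
      obtain ⟨t, ht⟩ := Ideal.mem_span_singleton'.mp (hmap (Ideal.mem_map_of_mem _ haℓ))
      exact ⟨t, ht.symm⟩
    -- the new third parameters
    obtain ⟨w₁, hw₁_le, hw₁_succ⟩ : ∃ w₁ : ∀ n, Rn n,
        (∀ n, n ≤ N → w₁ n = w n - compHom φ n ℓ * u n ^ (p N - p n + 1)) ∧
        w₁ (N + 1) = w' + φ N (a - compHom φ N ℓ) :=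
      ⟨Function.update (fun n => w n - compHom φ n ℓ * u n ^ (p N - p n + 1)) (N + 1)
          (w' + φ N (a - compHom φ N ℓ)),
        fun n hn => Function.update_of_ne (by omega) _ _, Function.update_self _ _ _⟩
    refine ⟨w₁ 0, ?_, fun h => absurd hN h, w₁, rfl, ?_, ?_, ?_⟩
    · -- `v' − v = −ℓ u_0^{p_N}`
      have h1 : 1 ≤ p N := hp0 ▸ hpmono (Nat.zero_le N)
      rw [hw₁_le 0 (Nat.zero_le N), hw0, compHom_zero, RingHom.id_apply, hp0, Nat.sub_add_cancel h1]
      exact Ideal.mem_span_singleton'.mpr ⟨-ℓ, by ring⟩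
    · -- axial at the point steps `n < N + 1`
      intro n hn hptn
      rcases Nat.lt_succ_iff_lt_or_eq.mp hn with hn' | rfl
      · have hpn : p n + 1 ≤ p N := by rw [← (hpS n).1 hptn]; exact hpmono hn'
        have he : p N - p n + 1 = (p N - (p n + 1) + 1) + 1 := by omega
        rw [hw₁_le n hn'.le, hw₁_le (n + 1) hn', map_sub, map_mul, map_pow, hax n hn' hptn, ← hu n,
          ← compHom_succ, (hpS n).1 hptn, he, pow_succ]
        ring
      · rw [hw₁_le n le_rfl, hw₁_succ, Nat.sub_self, zero_add, pow_one, map_sub, map_mul, hwN, map_sub]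
        ring
    · -- the curve steps `n < N + 1` (`n = N` is excluded)
      intro n hn hptn
      rcases Nat.lt_succ_iff_lt_or_eq.mp hn with hn' | rfl
      · rw [hw₁_le n hn'.le, hw₁_le (n + 1) hn', hcv n hn' hptn, map_sub, map_mul, map_pow, ← hu n,
          ← compHom_succ, (hpS n).2 hptn]
      · exact absurd hN hptn
    · -- adapted regular systems at all levels `n ≤ N + 1`
      intro n hn
      rcases Nat.lt_succ_iff_lt_or_eq.mp (Nat.lt_succ_of_le hn) with hn' | rfl
      · -- `n ≤ N`: the shear `w_n ↦ w_n − (Φ_n(ℓ) u_n^{p_N − p_n}) u_n` keeps everything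
        have hnN : n ≤ N := Nat.lt_succ_iff.mp hn'
        obtain ⟨yn, hgn, hPn, hadn⟩ := hgood n hnN
        have hw₁n : w₁ n = w n - (compHom φ n ℓ * u n ^ (p N - p n)) * u n := by
          rw [hw₁_le n hnN, pow_succ, mul_assoc]
        have hgn₁ : Ideal.span {yn, u n, w₁ n} = maximalIdeal (Rn n) := by
          rw [hw₁n, span_triple_sub_mul_snd]; exact hgn
        exact ⟨yn, hgn₁, hPn, forall_initialForms_of_eq_zero (![yn, u n, w n]) (hdim n) (hIμ n)
          (![yn, u n, w₁ n]) hgn hgn₁ rfl hadn⟩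
      · -- level `N + 1`
        have hgen₁ : Ideal.span {y', u (N + 1), w₁ (N + 1)} = maximalIdeal (Rn (N + 1)) := by
          rw [hw₁_succ, ht, hu N, span_triple_add_mul_snd]; exact hgen'
        have hφ' : (maximalIdeal (Rn N)).map (φ N) ≤ Ideal.span {u (N + 1), w₁ (N + 1)} :=
          hmap.trans (by rw [hu N]; exact Ideal.span_mono (Set.singleton_subset_iff.mpr (by simp)))
        have hJφ : (I N).map (φ N) ≤ Ideal.span {φ N (u N) ^ μ} :=
          calc (I N).map (φ N) ≤ (maximalIdeal (Rn N) ^ μ).map (φ N) := Ideal.map_mono (hIμ N)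
            _ = ((maximalIdeal (Rn N)).map (φ N)) ^ μ := Ideal.map_pow _ _ _
            _ ≤ Ideal.span {φ N (u N)} ^ μ := Ideal.pow_right_mono hmap μ
            _ = Ideal.span {φ N (u N) ^ μ} := Ideal.span_singleton_pow _ _
        have hP' : ¬ pt (N + 1) → ∃ r₁ r₂ : Rn (N + 1),
            Ideal.span {y' + (r₁ * u (N + 1) + r₂ * w₁ (N + 1)), u (N + 1)} = P (N + 1) := fun hN1 =>
          ⟨0, 0, by
            rw [zero_mul, zero_mul, add_zero, add_zero]
            exact hPsucc_pt N hN hN1 y (w N) y' hgenN hadN hy'⟩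
        exact exists_adapted_coordinate_succ hdim φ I hμ u hu pt hIμ hIne hτ hI P hIP N y (w N) hgenN
          hadN y' (w₁ (N + 1)) hgen₁ hy' hφ' hJφ hP'
  · -- CURVE STEP at level `N`
    have hPN' := hPN hN
    obtain ⟨y', hy', hgen'⟩ := hcurve N hN y (w N) hPN' hgenN hadN
    have hmap : (maximalIdeal (Rn N)).map (φ N) ≤ Ideal.span {φ N (u N), φ N (w N)} := by
      rw [← hgenN, Ideal.map_span, Ideal.span_le]
      rintro _ ⟨x, hx, rfl⟩
      rcases hx with rfl | rfl | rfl
      · rw [SetLike.mem_coe, hy']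
        exact Ideal.mul_mem_right _ _ (Ideal.subset_span (by simp))
      · exact Ideal.subset_span (by simp)
      · exact Ideal.subset_span (by simp)
    have hPmap : (P N).map (φ N) ≤ Ideal.span {φ N (u N)} := by
      rw [← hPN', Ideal.map_span, Ideal.span_le]
      rintro _ ⟨x, hx, rfl⟩
      rcases hx with rfl | rfl
      · exact Ideal.mem_span_singleton'.mpr ⟨y', by rw [hy', mul_comm]⟩
      · exact Ideal.subset_span rfl
    obtain ⟨w₁, hw₁_le, hw₁_succ⟩ : ∃ w₁ : ∀ n, Rn n,
        (∀ n, n ≤ N → w₁ n = w n) ∧ w₁ (N + 1) = φ N (w N) :=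
      ⟨Function.update w (N + 1) (φ N (w N)), fun n hn => Function.update_of_ne (by omega) _ _,
        Function.update_self _ _ _⟩
    refine ⟨w₁ 0, ?_, fun _ => by rw [hw₁_le 0 (Nat.zero_le N), hw0], w₁, rfl, ?_, ?_, ?_⟩
    · rw [hw₁_le 0 (Nat.zero_le N), hw0, sub_self]; exact Ideal.zero_mem _
    · intro n hn hptn
      rcases Nat.lt_succ_iff_lt_or_eq.mp hn with hn' | rfl
      · rw [hw₁_le n hn'.le, hw₁_le (n + 1) hn']; exact hax n hn' hptn
      · exact absurd hptn hN
    · intro n hn hptn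
      rcases Nat.lt_succ_iff_lt_or_eq.mp hn with hn' | rfl
      · rw [hw₁_le n hn'.le, hw₁_le (n + 1) hn']; exact hcv n hn' hptn
      · rw [hw₁_succ, hw₁_le n le_rfl]
    · intro n hn
      rcases Nat.lt_succ_iff_lt_or_eq.mp (Nat.lt_succ_of_le hn) with hn' | rfl
      · have hnN : n ≤ N := Nat.lt_succ_iff.mp hn'
        rw [hw₁_le n hnN]; exact hgood n hnN
      · have hgen₁ : Ideal.span {y', u (N + 1), w₁ (N + 1)} = maximalIdeal (Rn (N + 1)) := by
          rw [hw₁_succ, hu N]; exact hgen'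
        have hφ' : (maximalIdeal (Rn N)).map (φ N) ≤ Ideal.span {u (N + 1), w₁ (N + 1)} := by
          rw [hw₁_succ, hu N]; exact hmap
        have hJφ : (I N).map (φ N) ≤ Ideal.span {φ N (u N) ^ μ} :=
          calc (I N).map (φ N) ≤ (P N ^ μ).map (φ N) := Ideal.map_mono (hIP N hN)
            _ = ((P N).map (φ N)) ^ μ := Ideal.map_pow _ _ _
            _ ≤ Ideal.span {φ N (u N)} ^ μ := Ideal.pow_right_mono hPmap μ
            _ = Ideal.span {φ N (u N) ^ μ} := Ideal.span_singleton_pow _ _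
        have hP' : ¬ pt (N + 1) → ∃ r₁ r₂ : Rn (N + 1),
            Ideal.span {y' + (r₁ * u (N + 1) + r₂ * w₁ (N + 1)), u (N + 1)} = P (N + 1) := by
          intro hN1
          obtain ⟨-, β, hβ, hPβ⟩ := hPsucc_cv N hN hN1 y (w N) y' hPN' hgenN hadN hy'
          obtain ⟨r₁, r₂, hr⟩ := Ideal.mem_span_pair.mp (hmap (Ideal.mem_map_of_mem _ hβ))
          refine ⟨r₁, r₂, ?_⟩
          rw [hw₁_succ, hu N, hr, ← hu N]
          exact hPβ
        exact exists_adapted_coordinate_succ hdim φ I hμ u hu pt hIμ hIne hτ hI P hIP N y (w N) hgenN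
          hadN y' (w₁ (N + 1)) hgen₁ hy' hφ' hJφ hP'

end Chain

/-- **B3 (OURS). Shear-lift recursion along a rational `τ = 1` unit chain.** Let
`R_0 → R_1 → ⋯` be local homomorphisms of three-dimensional regular local rings with surjective
residue field maps, `u_{n+1} = φ_n u_n`, ideals `I_n ⊆ 𝔪_n^μ`, `I_n ⊄ 𝔪_n^{μ+1}` (`1 ≤ μ`) with
`I_{n+1} = (I_n R_{n+1} : φ_n u_n^μ)` and `τ = 1` for every regular system of parameters at every
level; let `(y₀, u_0, w_0)` be adapted (`μ! < δs`). Suppose every level is a POINT step (`pt n`: for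
each adapted `(y, u_n, w)` the next centre is the origin of the `u`-chart after a translation
`w ↦ w − a u_n`) or a CURVE step (`¬ pt n`: the centre is `P_n = (y, u_n)` for the adapted `y`,
`I_n ⊆ P_n^μ`, and the next point is the origin of the `u`-chart), with the centres `P_{n+1}` of
consecutive steps related by `hPsucc_pt` / `hPsucc_cv`. Then for every depth `N` there are a
level-`0` third parameter `v_N` (`v_0 = w_0`, `v_{N+1} − v_N ∈ (u_0^{p_N})`, `v_{N+1} = v_N` when
`N` is a curve step, `p_0 = 1`, `p_{n+1} = p_n + [pt n]`) and transports `w_n` (`n ≤ N`, `w_0 = v_N`) which are AXIAL at every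
point step `n < N` (`φ_n w_n = φ_n u_n · w_{n+1}`) and unchanged at curve steps, each
`(y, u_n, w_n)` being a regular system of parameters for some adapted `y`, on the centre at curve
steps. This is the `u₂`-part of CJS Claim 13.8 (`u₂ ↦ u₂ + Σ φ_q u₁^{q+1}`), organised as the
`τ = 1` twin of `AdaptedChainRecursion.exists_corrected_coordinates`; the adapted `y` at each level
comes from the transported monic element and `τ = 1` (`exists_adapted_coordinate_succ`), on the
centre at curve levels because of `hIP`.
[cite: CossartJannsenSaito2020, Claim 13.8] [cite: CossartPiltant2008, Prop. 4.4 (proof, p. 11)] -/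
theorem exists_shearLift_coordinates
    (Rn : ℕ → Type u) [∀ n, CommRing (Rn n)] [∀ n, IsRegularLocalRing (Rn n)]
    (hdim : ∀ n, ringKrullDim (Rn n) = 3) (φ : ∀ n, Rn n →+* Rn (n + 1)) [∀ n, IsLocalHom (φ n)]
    (I : ∀ n, Ideal (Rn n)) {μ : ℕ} (hμ : 1 ≤ μ) (u : ∀ n, Rn n) (hu : ∀ n, u (n + 1) = φ n (u n))
    (pt : ℕ → Prop) (hpt0 : pt 0)
    (c₀ : Fin 3 → Rn 0) (hc₀ : Ideal.span {c₀ 0, c₀ 1, c₀ 2} = maximalIdeal (Rn 0)) (hc₀u : c₀ 1 = u 0)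
    (hδ₀ : μ.factorial < deltaS c₀ (I 0) μ)
    (hIμ : ∀ n, I n ≤ maximalIdeal (Rn n) ^ μ) (hIne : ∀ n, ¬ I n ≤ maximalIdeal (Rn n) ^ (μ + 1))
    (hτ : ∀ n (c : Fin 3 → Rn n), Ideal.span {c 0, c 1, c 2} = maximalIdeal (Rn n) →
      hironakaTauAt c (I n) μ = 1)
    (hres : ∀ n, Function.Surjective (ResidueField.map (φ n)))
    (hI : ∀ n, I (n + 1) = ((I n).map (φ n)).colon {φ n (u n) ^ μ})
    (hpoint : ∀ n, pt n → ∀ (y w : Rn n), Ideal.span {y, u n, w} = maximalIdeal (Rn n) →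
      (∀ G ∈ initialForms ![y, u n, w] (I n) μ, ∃ a : ResidueField (Rn n), G = C a * X 0 ^ μ) →
      ∃ (a : Rn n) (y' w' : Rn (n + 1)), φ n y = φ n (u n) * y' ∧ φ n (w - a * u n) = φ n (u n) * w' ∧
        Ideal.span {y', φ n (u n), w'} = maximalIdeal (Rn (n + 1)))
    (P : ∀ n, Ideal (Rn n)) (hIP : ∀ n, ¬ pt n → I n ≤ P n ^ μ)
    (hcurve : ∀ n, ¬ pt n → ∀ (y w : Rn n), Ideal.span {y, u n} = P n →
      Ideal.span {y, u n, w} = maximalIdeal (Rn n) →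
      (∀ G ∈ initialForms ![y, u n, w] (I n) μ, ∃ a : ResidueField (Rn n), G = C a * X 0 ^ μ) →
      ∃ y' : Rn (n + 1), φ n y = φ n (u n) * y' ∧
        Ideal.span {y', φ n (u n), φ n w} = maximalIdeal (Rn (n + 1)))
    (hPsucc_pt : ∀ n, pt n → ¬ pt (n + 1) → ∀ (y w : Rn n) (y' : Rn (n + 1)),
      Ideal.span {y, u n, w} = maximalIdeal (Rn n) →
      (∀ G ∈ initialForms ![y, u n, w] (I n) μ, ∃ a : ResidueField (Rn n), G = C a * X 0 ^ μ) →
      φ n y = φ n (u n) * y' → Ideal.span {y', u (n + 1)} = P (n + 1))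
    (hPsucc_cv : ∀ n, ¬ pt n → ¬ pt (n + 1) → ∀ (y w : Rn n) (y' : Rn (n + 1)),
      Ideal.span {y, u n} = P n →
      Ideal.span {y, u n, w} = maximalIdeal (Rn n) →
      (∀ G ∈ initialForms ![y, u n, w] (I n) μ, ∃ a : ResidueField (Rn n), G = C a * X 0 ^ μ) →
      φ n y = φ n (u n) * y' →
      u (n + 1) ∈ P (n + 1) ∧ ∃ β ∈ maximalIdeal (Rn n), Ideal.span {y' + φ n β, u (n + 1)} = P (n + 1)) :
    ∃ (v : ℕ → Rn 0) (p : ℕ → ℕ), v 0 = c₀ 2 ∧ p 0 = 1 ∧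
      (∀ N, (pt N → p (N + 1) = p N + 1) ∧ (¬ pt N → p (N + 1) = p N)) ∧
      (∀ N, v (N + 1) - v N ∈ Ideal.span {u 0 ^ p N}) ∧ (∀ N, ¬ pt N → v (N + 1) = v N) ∧
      ∀ N, ∃ w : ∀ n, Rn n, w 0 = v N ∧
        (∀ n, n < N → pt n → φ n (w n) = φ n (u n) * w (n + 1)) ∧
        (∀ n, n < N → ¬ pt n → w (n + 1) = φ n (w n)) ∧
        (∀ n, n ≤ N → ∃ y : Rn n, Ideal.span {y, u n, w n} = maximalIdeal (Rn n) ∧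
          (¬ pt n → Ideal.span {y, u n} = P n) ∧
          ∀ G ∈ initialForms ![y, u n, w n] (I n) μ, ∃ a : ResidueField (Rn n), G = C a * X 0 ^ μ) := by
  classical
  -- the exponent counter `p_N = 1 + #{point steps < N}`
  obtain ⟨p, hp0, hpS⟩ : ∃ p : ℕ → ℕ, p 0 = 1 ∧
      ∀ N, (pt N → p (N + 1) = p N + 1) ∧ (¬ pt N → p (N + 1) = p N) := by
    refine ⟨fun N => Nat.rec (motive := fun _ => ℕ) 1 (fun n ih => if pt n then ih + 1 else ih) N, rfl,
      fun N => ⟨fun h => ?_, fun h => ?_⟩⟩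
    · show (if pt N then _ + 1 else _) = _
      rw [if_pos h]
    · show (if pt N then _ + 1 else _) = _
      rw [if_neg h]
  -- the state of depth `N` over `v`, its start and its propagation
  obtain ⟨S, hS0, hSs, hSout⟩ : ∃ S : ℕ → Rn 0 → Prop, S 0 (c₀ 2) ∧
      (∀ N v, S N v → ∃ v' : Rn 0, v' - v ∈ Ideal.span {u 0 ^ p N} ∧ (¬ pt N → v' = v) ∧
        S (N + 1) v') ∧
      (∀ N v, S N v → ∃ w : ∀ n, Rn n, w 0 = v ∧
        (∀ n, n < N → pt n → φ n (w n) = φ n (u n) * w (n + 1)) ∧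
        (∀ n, n < N → ¬ pt n → w (n + 1) = φ n (w n)) ∧
        (∀ n, n ≤ N → ∃ y : Rn n, Ideal.span {y, u n, w n} = maximalIdeal (Rn n) ∧
          (¬ pt n → Ideal.span {y, u n} = P n) ∧
          ∀ G ∈ initialForms ![y, u n, w n] (I n) μ, ∃ a : ResidueField (Rn n), G = C a * X 0 ^ μ)) := by
    refine ⟨fun N v => ∃ w : ∀ n, Rn n, w 0 = v ∧
        (∀ n, n < N → pt n → φ n (w n) = φ n (u n) * w (n + 1)) ∧
        (∀ n, n < N → ¬ pt n → w (n + 1) = φ n (w n)) ∧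
        (∀ n, n ≤ N → ∃ y : Rn n, Ideal.span {y, u n, w n} = maximalIdeal (Rn n) ∧
          (¬ pt n → Ideal.span {y, u n} = P n) ∧
          ∀ G ∈ initialForms ![y, u n, w n] (I n) μ, ∃ a : ResidueField (Rn n), G = C a * X 0 ^ μ),
      ?_, fun N v h => ?_, fun N v h => ?_⟩
    · exact shearLift_zero hdim φ I u pt hIμ P hpt0 c₀ hc₀ hc₀u hδ₀
    · exact shearLift_succ hdim φ I hμ u hu pt hIμ hIne hτ hres hI P hIP hpoint hcurve hPsucc_pt
        hPsucc_cv p hp0 hpS N v h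
    · exact h
  choose next hnext_mem hnext_cv hnext_S using hSs
  -- the sequence `v_N`
  obtain ⟨v, hv0, hvS, hv_mem, hv_cv⟩ : ∃ v : ℕ → Rn 0, v 0 = c₀ 2 ∧ (∀ N, S N (v N)) ∧
      (∀ N, v (N + 1) - v N ∈ Ideal.span {u 0 ^ p N}) ∧ (∀ N, ¬ pt N → v (N + 1) = v N) := by
    let sq : (N : ℕ) → {x : Rn 0 // S N x} := fun N =>
      Nat.rec (motive := fun N => {x : Rn 0 // S N x}) ⟨c₀ 2, hS0⟩
        (fun N ih => ⟨next N ih.1 ih.2, hnext_S N ih.1 ih.2⟩) N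
    exact ⟨fun N => (sq N).1, rfl, fun N => (sq N).2, fun N => hnext_mem N (sq N).1 (sq N).2,
      fun N h => hnext_cv N (sq N).1 (sq N).2 h⟩
  exact ⟨v, p, hv0, hp0, hpS, hv_mem, hv_cv, fun N => hSout N (v N) (hvS N)⟩


end Literature.AlgebraicGeometry.Resolution

end
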